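import Mathlib
import Literature.Analysis.Complex.CauchyTransform
import Literature.Analysis.Complex.CauchyPompeiu
import Literature.Analysis.Complex.CauchyTransformHolderHigher
import Literature.Analysis.FunctionSpaces.ContDiffHolderSpace
import Literature.Analysis.FunctionSpaces.ContDiffHolderBilinear
import Literature.Analysis.FunctionSpaces.ContDiffHolderClosedGraph
import Literature.Analysis.FunctionSpaces.ContDiffHolderDiffOperator
import Summits.SmoothPoincare4.SmoothPoincare4.Theorems.SullivanDualTameOrBrodyR4CoreAOperators

/-!
# CORE-A of crux `TameOrBrodyR4` (stmt-SmoothPoincare4-7826), line `Sketch`: the cut-off Cauchy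
# transform as a bounded operator `C^{k,r}_b → C^{k+1,r}_b` at every Hölder order (lead c6, A1ₖ)

Order-`k` version of `CoreA.cutTransformCLM` (`…CoreAOperators.lean`, `k = 0`), over the
order-polymorphic Cauchy-transform package `Literature.Analysis.Complex.cauchyTransform_contDiffHolder_succ`
(T1k): for a smooth real cut-off `χ'` vanishing off a disc, `g ↦ T(χ' • g)` is a bounded operator
`C^{k,r}_b(ℂ, F) →L[ℝ] C^{k+1,r}_b(ℂ, F)` with `∂̄ 𝒯 g = χ' • g` and `𝒯 g → 0` at infinity. The
analytic input is the named-fact hypothesis `hT : CauchyTransformHolderApriori F r`.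
-/

-- the registered namespace `Summit.SmoothPoincare4.SmoothPoincare4.…` repeats a component
set_option linter.dupNamespace false

noncomputable section

open scoped ContDiff Topology NNReal
open Filter Set Function Literature.Analysis.Complex Literature.Analysis.FunctionSpaces

namespace Summit.SmoothPoincare4.SmoothPoincare4.Cruxes.TameOrBrodyR4.Sketch

namespace CoreA

variable {F : Type} [NormedAddCommGroup F] [NormedSpace ℂ F] [CompleteSpace F] [FiniteDimensional ℂ F]
variable {k : ℕ} {r : ℝ≥0}

omit [CompleteSpace F] [FiniteDimensional ℂ F] in
/-- A cut-off density of order `k` vanishes where the cut-off does. -/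
theorem coeff_apply_eq_zero_k {χ' : ℂ → ℝ} (hχ' : ContDiff ℝ ∞ χ') (hχ's : HasCompactSupport χ')
    (hr : r ≤ 1) (g : ContDiffHolderFunction ℂ F k r) {z : ℂ} (hz : χ' z = 0) :
    ContDiffHolderFunction.coeffCLM hr χ' hχ' hχ's g z = 0 := by
  rw [ContDiffHolderFunction.coeffCLM_apply, hz, zero_smul]

/-- **Membership at order `k`**: for `g ∈ C^{k,r}_b`, `T(χ' • g) ∈ C^{k+1,r}_b`, `∂̄ T(χ' g) = χ' g`,
and `T(χ' g) → 0` at infinity. -/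
theorem memContDiffHolder_transform_k (hr0 : 0 < r) (hr1 : r < 1)
    (hT : CauchyTransformHolderApriori F r)
    {χ' : ℂ → ℝ} (hχ' : ContDiff ℝ ∞ χ') (hχ's : HasCompactSupport χ') {ρ : ℝ} (hρ : 0 < ρ)
    (hχ'ρ : ∀ z, ρ ≤ ‖z‖ → χ' z = 0) (g : ContDiffHolderFunction ℂ F k r) :
    MemContDiffHolder (k + 1) r
      (cauchyTransformAlong (1 : ℂ) (ContDiffHolderFunction.coeffCLM hr1.le χ' hχ' hχ's g)) ∧
    (∀ z, dbarAlong (1 : ℂ)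
      (cauchyTransformAlong (1 : ℂ) (ContDiffHolderFunction.coeffCLM hr1.le χ' hχ' hχ's g)) z =
        ContDiffHolderFunction.coeffCLM hr1.le χ' hχ' hχ's g z) ∧
    Tendsto (cauchyTransformAlong (1 : ℂ) (ContDiffHolderFunction.coeffCLM hr1.le χ' hχ' hχ's g))
      (cocompact ℂ) (𝓝 0) := by
  set d := ContDiffHolderFunction.coeffCLM hr1.le χ' hχ' hχ's g with hd
  obtain ⟨C, -, hC⟩ := cauchyTransform_contDiffHolder_succ F hr0 hr1 hT k ρ hρ
  have hdz : ∀ z, ρ ≤ ‖z‖ → d z = 0 := fun z hz => coeff_apply_eq_zero_k hχ' hχ's hr1.le g (hχ'ρ z hz)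
  obtain ⟨h1, -, h3, h4⟩ := hC d hdz
  exact ⟨h1, h3, h4⟩

/-- The underlying linear map `g ↦ T(χ' • g)` into `C^{k+1,r}_b`. -/
def transformₗk (hr0 : 0 < r) (hr1 : r < 1) (hT : CauchyTransformHolderApriori F r)
    {χ' : ℂ → ℝ} (hχ' : ContDiff ℝ ∞ χ') (hχ's : HasCompactSupport χ') {ρ : ℝ} (hρ : 0 < ρ)
    (hχ'ρ : ∀ z, ρ ≤ ‖z‖ → χ' z = 0) :
    ContDiffHolderFunction ℂ F k r →ₗ[ℝ] ContDiffHolderFunction ℂ F (k + 1) r where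
  toFun g := ⟨cauchyTransformAlong (1 : ℂ) (ContDiffHolderFunction.coeffCLM hr1.le χ' hχ' hχ's g),
    (memContDiffHolder_transform_k hr0 hr1 hT hχ' hχ's hρ hχ'ρ g).1⟩
  map_add' g g' := by
    apply ContDiffHolderFunction.ext
    intro z
    change cauchyTransformAlong 1
        (⇑(ContDiffHolderFunction.coeffCLM hr1.le χ' hχ' hχ's (g + g'))) z =
      cauchyTransformAlong 1 (⇑(ContDiffHolderFunction.coeffCLM hr1.le χ' hχ' hχ's g)) z +
        cauchyTransformAlong 1 (⇑(ContDiffHolderFunction.coeffCLM hr1.le χ' hχ' hχ's g')) z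
    rw [map_add]
    rw [show (⇑(ContDiffHolderFunction.coeffCLM hr1.le χ' hχ' hχ's g +
        ContDiffHolderFunction.coeffCLM hr1.le χ' hχ' hχ's g') : ℂ → F) =
        (ContDiffHolderFunction.coeffCLM hr1.le χ' hχ' hχ's g : ℂ → F) +
          (ContDiffHolderFunction.coeffCLM hr1.le χ' hχ' hχ's g' : ℂ → F) from rfl]
    exact cauchyTransformAlong_add (ContDiffHolderFunction.continuous _)
      (hasCompactSupport_of_eq_zero fun z hz => coeff_apply_eq_zero_k hχ' hχ's hr1.le g (hχ'ρ z hz))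
      (ContDiffHolderFunction.continuous _)
      (hasCompactSupport_of_eq_zero fun z hz => coeff_apply_eq_zero_k hχ' hχ's hr1.le g' (hχ'ρ z hz))
      one_ne_zero z
  map_smul' c g := by
    apply ContDiffHolderFunction.ext
    intro z
    change cauchyTransformAlong 1
        (⇑(ContDiffHolderFunction.coeffCLM hr1.le χ' hχ' hχ's (c • g))) z =
      c • cauchyTransformAlong 1 (⇑(ContDiffHolderFunction.coeffCLM hr1.le χ' hχ' hχ's g)) z
    rw [map_smul]
    rw [show (⇑(c • ContDiffHolderFunction.coeffCLM hr1.le χ' hχ' hχ's g) : ℂ → F) =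
        (c : ℂ) • (ContDiffHolderFunction.coeffCLM hr1.le χ' hχ' hχ's g : ℂ → F) by
      funext w
      change c • (ContDiffHolderFunction.coeffCLM hr1.le χ' hχ' hχ's g) w = (c : ℂ) • _
      exact (Complex.coe_smul c _).symm]
    rw [cauchyTransformAlong_const_smul, Complex.coe_smul]

/-- **The cut-off Cauchy transform at order `k`** `g ↦ T(χ' • g)` as a bounded operator
`C^{k,r}_b(ℂ, F) →L[ℝ] C^{k+1,r}_b(ℂ, F)` (closed graph: point evaluations are continuous). -/
def cutTransformCLMk (hr0 : 0 < r) (hr1 : r < 1) (hT : CauchyTransformHolderApriori F r)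
    {χ' : ℂ → ℝ} (hχ' : ContDiff ℝ ∞ χ') (hχ's : HasCompactSupport χ') {ρ : ℝ} (hρ : 0 < ρ)
    (hχ'ρ : ∀ z, ρ ≤ ‖z‖ → χ' z = 0) :
    ContDiffHolderFunction ℂ F k r →L[ℝ] ContDiffHolderFunction ℂ F (k + 1) r :=
  ContDiffHolderFunction.clmOfContinuousEval (transformₗk hr0 hr1 hT hχ' hχ's hρ hχ'ρ) fun z => by
    -- `g ↦ T(χ' g)(z)` is linear and bounded by the uniform sup bound `6ρ‖χ' g‖_∞ ≤ 6ρ ‖coeff‖ ‖g‖`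
    set Mχ := (ContDiffHolderFunction.coeffCLM hr1.le χ' hχ' hχ's :
      ContDiffHolderFunction ℂ F k r →L[ℝ] ContDiffHolderFunction ℂ F k r) with hMχ
    let Lz : ContDiffHolderFunction ℂ F k r →ₗ[ℝ] F :=
      { toFun := fun g => transformₗk hr0 hr1 hT hχ' hχ's hρ hχ'ρ g z
        map_add' := fun g g' => by rw [map_add]; rfl
        map_smul' := fun c g => by rw [map_smul]; rfl }
    have hLz : ∀ g, ‖Lz g‖ ≤ 6 * ρ * ‖Mχ‖ * ‖g‖ := by
      intro g
      set d := Mχ g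
      have hdz : ∀ z, ρ ≤ ‖z‖ → d z = 0 := fun z hz =>
        coeff_apply_eq_zero_k hχ' hχ's hr1.le g (hχ'ρ z hz)
      have hsupp : ∀ w, d w ≠ 0 → ‖w‖ < ρ := fun w hw => by
        by_contra h
        exact hw (hdz w (le_of_not_gt h))
      have hbound := norm_cauchyTransform_le_uniform (h := (d : ℂ → F)) hρ.le (norm_nonneg d)
        hsupp (fun w => d.norm_apply_le_norm w) z
      calc ‖Lz g‖ = ‖cauchyTransformAlong (1 : ℂ) (d : ℂ → F) z‖ := rfl
        _ ≤ 6 * ρ * ‖d‖ := hbound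
        _ ≤ 6 * ρ * (‖Mχ‖ * ‖g‖) := by gcongr; exact Mχ.le_opNorm g
        _ = 6 * ρ * ‖Mχ‖ * ‖g‖ := by ring
    exact (Lz.mkContinuous _ hLz).continuous

/-- Pointwise formula for `cutTransformCLMk`. -/
@[simp]
theorem cutTransformCLMk_apply (hr0 : 0 < r) (hr1 : r < 1) (hT : CauchyTransformHolderApriori F r)
    {χ' : ℂ → ℝ} (hχ' : ContDiff ℝ ∞ χ') (hχ's : HasCompactSupport χ') {ρ : ℝ} (hρ : 0 < ρ)
    (hχ'ρ : ∀ z, ρ ≤ ‖z‖ → χ' z = 0) (g : ContDiffHolderFunction ℂ F k r) (z : ℂ) :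
    cutTransformCLMk hr0 hr1 hT hχ' hχ's hρ hχ'ρ g z =
      cauchyTransformAlong (1 : ℂ) (ContDiffHolderFunction.coeffCLM hr1.le χ' hχ' hχ's g) z := rfl

/-- `∂̄` of the order-`k` cut-off Cauchy transform returns the cut-off density. -/
theorem dbarAlong_cutTransformCLMk (hr0 : 0 < r) (hr1 : r < 1)
    (hT : CauchyTransformHolderApriori F r) {χ' : ℂ → ℝ} (hχ' : ContDiff ℝ ∞ χ')
    (hχ's : HasCompactSupport χ') {ρ : ℝ} (hρ : 0 < ρ) (hχ'ρ : ∀ z, ρ ≤ ‖z‖ → χ' z = 0)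
    (g : ContDiffHolderFunction ℂ F k r) (z : ℂ) :
    dbarAlong (1 : ℂ) (cutTransformCLMk hr0 hr1 hT hχ' hχ's hρ hχ'ρ g) z = χ' z • g z :=
  (memContDiffHolder_transform_k hr0 hr1 hT hχ' hχ's hρ hχ'ρ g).2.1 z

/-- The order-`k` cut-off Cauchy transform tends to `0` at infinity. -/
theorem tendsto_cutTransformCLMk (hr0 : 0 < r) (hr1 : r < 1)
    (hT : CauchyTransformHolderApriori F r) {χ' : ℂ → ℝ} (hχ' : ContDiff ℝ ∞ χ')
    (hχ's : HasCompactSupport χ') {ρ : ℝ} (hρ : 0 < ρ) (hχ'ρ : ∀ z, ρ ≤ ‖z‖ → χ' z = 0)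
    (g : ContDiffHolderFunction ℂ F k r) :
    Tendsto (cutTransformCLMk hr0 hr1 hT hχ' hχ's hρ hχ'ρ g : ℂ → F) (cocompact ℂ) (𝓝 0) :=
  (memContDiffHolder_transform_k hr0 hr1 hT hχ' hχ's hρ hχ'ρ g).2.2

end CoreA

/-- **Registered helper `helper_cutTransformPackageK`**: at every Hölder order `k`, given the a
priori Hölder estimate for the Cauchy transform (named fact `CauchyTransformHolderApriori`) and a
smooth compactly supported cut-off `χ'` vanishing off the disc of radius `ρ`, there is a bounded
operator `𝒯 : C^{k,r}_b(ℂ, F) →L[ℝ] C^{k+1,r}_b(ℂ, F)` with `𝒯 g = T(χ' • g)` pointwise,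
`∂̄ (𝒯 g) = χ' • g`, and `𝒯 g → 0` at infinity. -/
theorem helper_cutTransformPackageK {F : Type} [NormedAddCommGroup F] [NormedSpace ℂ F]
    [CompleteSpace F] [FiniteDimensional ℂ F] {k : ℕ} {r : ℝ≥0} (hr0 : 0 < r) (hr1 : r < 1)
    (hT : CauchyTransformHolderApriori F r) (χ' : ℂ → ℝ) (hχ' : ContDiff ℝ ∞ χ')
    (hχ's : HasCompactSupport χ') (ρ : ℝ) (hρ : 0 < ρ) (hχ'ρ : ∀ z, ρ ≤ ‖z‖ → χ' z = 0) :
    ∃ 𝒯 : ContDiffHolderFunction ℂ F k r →L[ℝ] ContDiffHolderFunction ℂ F (k + 1) r,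
      (∀ (g : ContDiffHolderFunction ℂ F k r) (z : ℂ),
        𝒯 g z = cauchyTransformAlong (1 : ℂ) (fun w => χ' w • g w) z) ∧
      (∀ (g : ContDiffHolderFunction ℂ F k r) (z : ℂ), dbarAlong (1 : ℂ) (𝒯 g) z = χ' z • g z) ∧
      (∀ g : ContDiffHolderFunction ℂ F k r, Tendsto (𝒯 g : ℂ → F) (cocompact ℂ) (𝓝 0)) :=
  ⟨CoreA.cutTransformCLMk hr0 hr1 hT hχ' hχ's hρ hχ'ρ, fun _ _ => rfl,
    CoreA.dbarAlong_cutTransformCLMk hr0 hr1 hT hχ' hχ's hρ hχ'ρ,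
    CoreA.tendsto_cutTransformCLMk hr0 hr1 hT hχ' hχ's hρ hχ'ρ⟩

end Summit.SmoothPoincare4.SmoothPoincare4.Cruxes.TameOrBrodyR4.Sketch
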